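/-
Copyright (c) 2026. All rights reserved.
Released under Apache 2.0 license as described in the file LICENSE.
-/
import Summits.HodgeConjecture.HodgeConjecture.Theorems.K2LiuArchLadderPairTransport     -- ★ asm FILE 4 p861766 (`rung_pair`, pair algebra)
import Summits.HodgeConjecture.HodgeConjecture.Theorems.K2LiuArchLadderElementaryArrows  -- ★ asm FILE 3 p861724 (`op_single_m`, `op_single_p`)
import Summits.HodgeConjecture.HodgeConjecture.Theorems.K2LiuArchOneDimAnchors          -- ★ asm FILE 5 p861822 (`oneDim_anchor`)
import Summits.HodgeConjecture.HodgeConjecture.Theorems.K2LiuU22KTypeArrowClosure       -- ★ S2-C∕S2-T on the carrier (`mOp_zero_zero_fkl_carrier`, `pOp_one_one_fkl_carrier`)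
import HarnessLib

/-!
# Crux `HLiu418`, G6-arch ASSEMBLY FILE 6: THE SCALAR OF `M_w(s)` ON EVERY `K_w`-TYPE `(k′, l′)` OF `I_w(s, χ_k)` ON `U(2,2)`, BY VALUE, `re s > ½` —
# `cp M_w(s) F = (c_{k,l′}(s) · ∏_{j<k′} (−s+1+k∕2+j+l′)) • f_{k′,l′}` for a section `F` with `cp F = (∏_{j<k′} (s+1+k∕2+j+l′)) • f_{k′,l′}`

Cell `hodgecm-mathlib`, crux item hLiu418 = `stmt-HodgeConjecture-24832` (helper lane `--supports`, count-neutral).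

The composition of ★ asm FILE 5 (one-dimensional anchor at the type `(0, l′)`), ★ asm FILE 4 (pair transport), ★ asm FILE 3 (`op_single_m`) and ★ S2-T on the
carrier (`M₀₀ f_{j,l′} = (q + j + l′) f_{j+1,l′}`, `q = s+1−(−k)∕2`, ★ `K2LiuU22KTypeArrowClosure.mOp_zero_zero_fkl_carrier`): `k′` clean `M₀₀`-arrows climb from
`D^{l′} = f_{0,l′}` to the highest-weight vector `f_{k′,l′} = u₀₀^{k′} D^{l′}` of the type `(k′, l′)`.  Stated in PAIR (multiplied-out) form — no division, no «live
arrow» hypothesis: at the isolated `s` where a source scalar `s+1+k∕2+j+l′` vanishes the identity still holds (both sides acquire the factor).  Where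
`∏ (s+1+k∕2+j+l′) ≠ 0`, ★ asm FILE 4 `scalar_of_pair` normalises to `cp F = f_{k′,l′}`, `cp M_w F = c_{(k′,l′)}(s) • f_{k′,l′}` with
`c_{(k′,l′)}(s) = c_{k,l′}(s) · ∏_{j<k′} (−s+1+k∕2+j+l′)∕(s+1+k∕2+j+l′)` — the by-value `hpath` of ★ (c1) `K2LiuArchLadderMeromorphicPackage`.
* §1 **`ladder_pair_from`** — ★ FILE 4 `ladder_pair` from an ARBITRARY anchor pair `(F₀; Q_0, Q′_0)`.
* §2 **`kType_pair`** — the theorem of the title (route `M₀₀` from `(0, l′)`); **`kType_pair'`** — the twin route by `k′` clean `P₁₁`-arrows from the anchor `(0, k′+l′)`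
  (`P₁₁ f_{j,m} = (p − m) f_{j+1,m−1}`, `p = s+1+(−k)∕2`): `cp F = (∏_{j<k′} (s+1−k∕2−(k′+l′)+j)) • f_{k′,l′}`, `cp M_w F = (c_{k,k′+l′}(s)·∏_{j<k′} (−s+1−k∕2−(k′+l′)+j)) • f_{k′,l′}`.
References: [LeeZhu1998, §5 p. 5032, Prop. 5.4]; [Shimura1982, (1.31)]; [Shimura1997, §16.4]; [Knapp1986, Ch. VIII §3].
HONEST LABEL: HC_CM is proved only modulo the 7 printed citations (2 remaining named inputs: hLiu418 = stmt-HodgeConjecture-24832,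
h413 = stmt-HodgeConjecture-24833) until rung 0 closes; count-neutral helper, closes no socket.
-/

set_option autoImplicit false
set_option linter.dupNamespace false

noncomputable section

open Complex Matrix MeasureTheory NormedSpace
open scoped ComplexConjugate ComplexOrder

namespace Summit.HodgeConjecture.HodgeConjecture.Cruxes.HLiu418.K2LiuArchKTypeScalars

open Summit.HodgeConjecture.HodgeConjecture.Cruxes.HLiu418.K2LiuHermTwoGammaDefs (hermTwoGamma)
open Summit.HodgeConjecture.HodgeConjecture.Cruxes.HLiu418.K2LiuArchInducedTubeDefs
open Summit.HodgeConjecture.HodgeConjecture.Cruxes.HLiu418.K2LiuU22CompactPictureDefs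
open Summit.HodgeConjecture.HodgeConjecture.Cruxes.HLiu418.K2LiuU22CompactPictureOperatorDictionary
open Summit.HodgeConjecture.HodgeConjecture.Cruxes.HLiu418.K2LiuU22KTypeArrowClosure (mOp_zero_zero_fkl_carrier pOp_one_one_fkl_carrier)
open Summit.HodgeConjecture.HodgeConjecture.Cruxes.HLiu418.K2LiuArchLadderPairTransport (rung_pair)
open Summit.HodgeConjecture.HodgeConjecture.Cruxes.HLiu418.K2LiuArchLadderElementaryArrows (op_single_m op_single_p)
open Summit.HodgeConjecture.HodgeConjecture.Cruxes.HLiu418.K2LiuArchOneDimAnchors (oneDim_anchor)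

/-! ## §1  The pair along a word from an arbitrary anchor -/

/-- **THE PAIR ALONG A WORD FROM ANY ANCHOR** (`re s > ½`): anchor section `F₀ ∈ I_w(s,χ_k)` with `cp F₀ = Q_0`, `cp M_w F₀ = Q′_0`; blocks `(α β γ δ)_i` and
consumer-supplied `Q_{i+1} = Op^{(k,s)}_i Q_i`, `Q′_{i+1} = Op^{(k,−s)}_i Q′_i` (`i < n`) ⇒ `∃ F ∈ I_w(s,χ_k)`, `cp F = Q_n`, `cp M_w F = Q′_n` (`n ×` ★ FILE 4 `rung_pair`).
[LeeZhu1998, §5 p. 5032] -/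
theorem ladder_pair_from (k : ℤ) {s : ℂ} (hs : 1 / 2 < s.re) {F₀ : Matrix (Fin 2 ⊕ Fin 2) (Fin 2 ⊕ Fin 2) ℂ → ℂ} (hF₀ : IsArchSiegelSection (fun z : ℂ => (conj z / ((‖z‖ : ℝ) : ℂ)) ^ k) s F₀)
    (α β γ δ : ℕ → Matrix (Fin 2) (Fin 2) ℂ) (Q Q' : ℕ → Carrier)
    (hQ0 : ∀ (v : Matrix (Fin 2) (Fin 2) ℂ), vᴴ * v = 1 → ∀ hv : v.det ≠ 0, F₀ ((2 : ℂ)⁻¹ • fromBlocks (1 + v) (-(I • (1 - v))) (I • (1 - v)) (1 + v) : Matrix (Fin 2 ⊕ Fin 2) (Fin 2 ⊕ Fin 2) ℂ) = evalAt v hv (Q 0))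
    (hQ'0 : ∀ (u : Matrix (Fin 2) (Fin 2) ℂ), uᴴ * u = 1 → ∀ hu' : u.det ≠ 0,
        archIntertwining F₀ ((2 : ℂ)⁻¹ • fromBlocks (1 + u) (-(I • (1 - u))) (I • (1 - u)) (1 + u) : Matrix (Fin 2 ⊕ Fin 2) (Fin 2 ⊕ Fin 2) ℂ) = evalAt u hu' (Q' 0)) (n : ℕ)
    (hQ : ∀ i < n, Q (i + 1) = (∑ a' : Fin 2, ∑ b' : Fin 2, β i a' b' • pOp pd uMat dInv (s + 1 + (-(k : ℂ)) / 2) a' b' (Q i) +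
          ∑ a' : Fin 2, ∑ b' : Fin 2, γ i a' b' • mOp pd uMat (s + 1 - (-(k : ℂ)) / 2) a' b' (Q i) + ((-(k : ℂ)) * (α i).trace) • (Q i) -
          ∑ a' : Fin 2, ∑ b' : Fin 2, α i a' b' • lOp pd uMat a' b' (Q i) + ∑ a' : Fin 2, ∑ b' : Fin 2, δ i a' b' • rOp pd uMat a' b' (Q i)))
    (hQ' : ∀ i < n, Q' (i + 1) = (∑ a' : Fin 2, ∑ b' : Fin 2, β i a' b' • pOp pd uMat dInv (-s + 1 + (-(k : ℂ)) / 2) a' b' (Q' i) +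
          ∑ a' : Fin 2, ∑ b' : Fin 2, γ i a' b' • mOp pd uMat (-s + 1 - (-(k : ℂ)) / 2) a' b' (Q' i) + ((-(k : ℂ)) * (α i).trace) • (Q' i) -
          ∑ a' : Fin 2, ∑ b' : Fin 2, α i a' b' • lOp pd uMat a' b' (Q' i) + ∑ a' : Fin 2, ∑ b' : Fin 2, δ i a' b' • rOp pd uMat a' b' (Q' i))) :
    ∃ F : Matrix (Fin 2 ⊕ Fin 2) (Fin 2 ⊕ Fin 2) ℂ → ℂ, IsArchSiegelSection (fun z : ℂ => (conj z / ((‖z‖ : ℝ) : ℂ)) ^ k) s F ∧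
      (∀ (v : Matrix (Fin 2) (Fin 2) ℂ), vᴴ * v = 1 → ∀ hv : v.det ≠ 0, F ((2 : ℂ)⁻¹ • fromBlocks (1 + v) (-(I • (1 - v))) (I • (1 - v)) (1 + v) : Matrix (Fin 2 ⊕ Fin 2) (Fin 2 ⊕ Fin 2) ℂ) = evalAt v hv (Q n)) ∧
      (∀ (u : Matrix (Fin 2) (Fin 2) ℂ), uᴴ * u = 1 → ∀ hu' : u.det ≠ 0,
        archIntertwining F ((2 : ℂ)⁻¹ • fromBlocks (1 + u) (-(I • (1 - u))) (I • (1 - u)) (1 + u) : Matrix (Fin 2 ⊕ Fin 2) (Fin 2 ⊕ Fin 2) ℂ) = evalAt u hu' (Q' n)) := by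
  induction n with
  | zero => exact ⟨F₀, hF₀, hQ0, hQ'0⟩
  | succ n ih =>
    obtain ⟨F, hF, hFQ, hFM⟩ := ih (fun i hi => hQ i (Nat.lt_succ_of_lt hi)) (fun i hi => hQ' i (Nat.lt_succ_of_lt hi))
    obtain ⟨h0, h1, h2⟩ := rung_pair k hs hF (Q n) (Q' n) hFQ hFM (α n) (β n) (γ n) (δ n)
    exact ⟨_, h0, fun v hv hv' => (h1 v hv hv').trans (by rw [hQ n (Nat.lt_succ_self n)]),
      fun u hu hu' => (h2 u hu hu').trans (by rw [hQ' n (Nat.lt_succ_self n)])⟩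

/-! ## §2  Every `K_w`-type -/

/-- **THE SCALAR OF `M_w(s)` ON THE TYPE `(k′, l′)`, PAIR FORM, ROUTE `M₀₀`** (`re s > ½`; `q(s) = s+1−(−k)∕2 = s+1+k∕2`): there is `F ∈ I_w(s,χ_k)` with
`cp F = (∏_{j<k′} (q(s)+j+l′)) • f_{k′,l′}` and `cp M_w(s) F = (c_{k,l′}(s) · ∏_{j<k′} (q(−s)+j+l′)) • f_{k′,l′}`, `c_{k,l′}(s)` the one-dimensional anchor scalar of
★ asm FILE 5 — `k′` clean `M₀₀`-arrows (★ S2-T) from the anchor `(0, l′)` through ★ FILE 4's pair transport.  [LeeZhu1998, §5 p. 5032, Prop. 5.4] [Shimura1982, (1.31)] -/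
theorem kType_pair (k : ℤ) {s : ℂ} (hs : 1 / 2 < s.re) (k' : ℕ) (l' : ℤ) :
    ∃ F : Matrix (Fin 2 ⊕ Fin 2) (Fin 2 ⊕ Fin 2) ℂ → ℂ, IsArchSiegelSection (fun z : ℂ => (conj z / ((‖z‖ : ℝ) : ℂ)) ^ k) s F ∧
      (∀ (v : Matrix (Fin 2) (Fin 2) ℂ), vᴴ * v = 1 → ∀ hv : v.det ≠ 0, F ((2 : ℂ)⁻¹ • fromBlocks (1 + v) (-(I • (1 - v))) (I • (1 - v)) (1 + v) : Matrix (Fin 2 ⊕ Fin 2) (Fin 2 ⊕ Fin 2) ℂ) = evalAt v hv ((∏ j ∈ Finset.range k', (s + 1 - (-(k : ℂ)) / 2 + j + l')) • fkl uMat dz k' l')) ∧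
      (∀ (u : Matrix (Fin 2) (Fin 2) ℂ), uᴴ * u = 1 → ∀ hu' : u.det ≠ 0,
        archIntertwining F ((2 : ℂ)⁻¹ • fromBlocks (1 + u) (-(I • (1 - u))) (I • (1 - u)) (1 + u) : Matrix (Fin 2 ⊕ Fin 2) (Fin 2 ⊕ Fin 2) ℂ) = evalAt u hu' ((((1 / 8 : ℂ) * (((4 * Real.pi ^ 4 : ℝ) : ℂ) * cexp ((Real.pi * I) * (k + 2 * l')) * (hermTwoGamma (s + 1 - k / 2 - l'))⁻¹ *
            (hermTwoGamma (s + 1 + k / 2 + l'))⁻¹ * (hermTwoGamma (2 * s) * (4 : ℂ) ^ (-(2 * s))))) *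
            ∏ j ∈ Finset.range k', (-s + 1 - (-(k : ℂ)) / 2 + j + l')) • fkl uMat dz k' l')) := by
  obtain ⟨F₀, hF₀, h1, h2⟩ := oneDim_anchor k l' hs
  have hf0 : fkl uMat dz 0 l' = dz l' := by rw [fkl_apply, pow_zero, one_mul]
  refine ladder_pair_from k hs hF₀ (fun _ => (0 : Matrix (Fin 2) (Fin 2) ℂ)) (fun _ => (0 : Matrix (Fin 2) (Fin 2) ℂ)) (fun _ => Matrix.single 0 0 (1 : ℂ)) (fun _ => (0 : Matrix (Fin 2) (Fin 2) ℂ))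
    (fun j => (∏ i ∈ Finset.range j, (s + 1 - (-(k : ℂ)) / 2 + i + l')) • fkl uMat dz j l')
    (fun j => (((1 / 8 : ℂ) * (((4 * Real.pi ^ 4 : ℝ) : ℂ) * cexp ((Real.pi * I) * (k + 2 * l')) * (hermTwoGamma (s + 1 - k / 2 - l'))⁻¹ *
            (hermTwoGamma (s + 1 + k / 2 + l'))⁻¹ * (hermTwoGamma (2 * s) * (4 : ℂ) ^ (-(2 * s))))) *
      ∏ i ∈ Finset.range j, (-s + 1 - (-(k : ℂ)) / 2 + i + l')) • fkl uMat dz j l')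
    (fun v hv hv' => ?_) (fun u hu hu' => ?_) k' (fun j _ => ?_) (fun j _ => ?_)
  · rw [h1 v hv hv', Finset.prod_range_zero, one_smul, hf0]
  · rw [h2 u hu hu', Finset.prod_range_zero, mul_one, hf0]
  · rw [op_single_m, map_smul, mOp_zero_zero_fkl_carrier, smul_smul, Finset.prod_range_succ]
  · rw [op_single_m, map_smul, mOp_zero_zero_fkl_carrier, smul_smul, Finset.prod_range_succ]
    congr 1
    ring

/-- **THE TWIN ROUTE `P₁₁`** from the anchor `(0, k′+l′)` (`p(s) = s+1+(−k)∕2 = s+1−k∕2`; `P₁₁ f_{j,m} = (p−m) f_{j+1,m−1}`): there is `F ∈ I_w(s,χ_k)` with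
`cp F = (∏_{j<k′} (p(s) − (k′+l′−j))) • f_{k′,l′}` and `cp M_w(s) F = (c_{k,k′+l′}(s)·∏_{j<k′} (p(−s) − (k′+l′−j))) • f_{k′,l′}`.  (Use whichever route is live at the `s` at hand.)
[LeeZhu1998, §5 p. 5032, Prop. 5.4] [Shimura1982, (1.31)] -/
theorem kType_pair' (k : ℤ) {s : ℂ} (hs : 1 / 2 < s.re) (k' : ℕ) (l' : ℤ) :
    ∃ F : Matrix (Fin 2 ⊕ Fin 2) (Fin 2 ⊕ Fin 2) ℂ → ℂ, IsArchSiegelSection (fun z : ℂ => (conj z / ((‖z‖ : ℝ) : ℂ)) ^ k) s F ∧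
      (∀ (v : Matrix (Fin 2) (Fin 2) ℂ), vᴴ * v = 1 → ∀ hv : v.det ≠ 0, F ((2 : ℂ)⁻¹ • fromBlocks (1 + v) (-(I • (1 - v))) (I • (1 - v)) (1 + v) : Matrix (Fin 2 ⊕ Fin 2) (Fin 2 ⊕ Fin 2) ℂ) = evalAt v hv ((∏ j ∈ Finset.range k', (s + 1 + (-(k : ℂ)) / 2 - (((k' : ℤ) + l' - j : ℤ) : ℂ))) • fkl uMat dz k' l')) ∧
      (∀ (u : Matrix (Fin 2) (Fin 2) ℂ), uᴴ * u = 1 → ∀ hu' : u.det ≠ 0,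
        archIntertwining F ((2 : ℂ)⁻¹ • fromBlocks (1 + u) (-(I • (1 - u))) (I • (1 - u)) (1 + u) : Matrix (Fin 2 ⊕ Fin 2) (Fin 2 ⊕ Fin 2) ℂ) = evalAt u hu' ((((1 / 8 : ℂ) * (((4 * Real.pi ^ 4 : ℝ) : ℂ) * cexp ((Real.pi * I) * (k + 2 * (((k' : ℤ) + l' : ℤ) : ℂ))) * (hermTwoGamma (s + 1 - k / 2 - (((k' : ℤ) + l' : ℤ) : ℂ)))⁻¹ *
            (hermTwoGamma (s + 1 + k / 2 + (((k' : ℤ) + l' : ℤ) : ℂ)))⁻¹ * (hermTwoGamma (2 * s) * (4 : ℂ) ^ (-(2 * s))))) *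
            ∏ j ∈ Finset.range k', (-s + 1 + (-(k : ℂ)) / 2 - (((k' : ℤ) + l' - j : ℤ) : ℂ))) • fkl uMat dz k' l')) := by
  obtain ⟨F₀, hF₀, h1, h2⟩ := oneDim_anchor k ((k' : ℤ) + l') hs
  have hf0 : fkl uMat dz 0 ((k' : ℤ) + l' - ((0 : ℕ) : ℤ)) = dz ((k' : ℤ) + l') := by rw [fkl_apply, pow_zero, one_mul, Nat.cast_zero, sub_zero]
  have hidx : ∀ j : ℕ, (k' : ℤ) + l' - ((j + 1 : ℕ) : ℤ) = (k' : ℤ) + l' - (j : ℤ) - 1 := fun j => by push_cast; ring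
  obtain ⟨F, hF, hFQ, hFM⟩ := ladder_pair_from k hs hF₀ (fun _ => (0 : Matrix (Fin 2) (Fin 2) ℂ)) (fun _ => Matrix.single 1 1 (1 : ℂ)) (fun _ => (0 : Matrix (Fin 2) (Fin 2) ℂ)) (fun _ => (0 : Matrix (Fin 2) (Fin 2) ℂ))
    (fun j => (∏ i ∈ Finset.range j, (s + 1 + (-(k : ℂ)) / 2 - (((k' : ℤ) + l' - i : ℤ) : ℂ))) • fkl uMat dz j ((k' : ℤ) + l' - j))
    (fun j => (((1 / 8 : ℂ) * (((4 * Real.pi ^ 4 : ℝ) : ℂ) * cexp ((Real.pi * I) * (k + 2 * (((k' : ℤ) + l' : ℤ) : ℂ))) * (hermTwoGamma (s + 1 - k / 2 - (((k' : ℤ) + l' : ℤ) : ℂ)))⁻¹ *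
            (hermTwoGamma (s + 1 + k / 2 + (((k' : ℤ) + l' : ℤ) : ℂ)))⁻¹ * (hermTwoGamma (2 * s) * (4 : ℂ) ^ (-(2 * s))))) *
      ∏ i ∈ Finset.range j, (-s + 1 + (-(k : ℂ)) / 2 - (((k' : ℤ) + l' - i : ℤ) : ℂ))) • fkl uMat dz j ((k' : ℤ) + l' - j))
    (fun v hv hv' => by rw [h1 v hv hv', Finset.prod_range_zero, one_smul, hf0])
    (fun u hu hu' => by rw [h2 u hu hu', Finset.prod_range_zero, mul_one, hf0]) k'
    (fun j _ => by rw [op_single_p, map_smul, pOp_one_one_fkl_carrier, smul_smul, Finset.prod_range_succ, hidx j])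
    (fun j _ => by rw [op_single_p, map_smul, pOp_one_one_fkl_carrier, smul_smul, Finset.prod_range_succ, hidx j]; congr 1; ring)
  refine ⟨F, hF, fun v hv hv' => ?_, fun u hu hu' => ?_⟩
  · rw [hFQ v hv hv', add_sub_cancel_left]
  · rw [hFM u hu hu', add_sub_cancel_left]

end Summit.HodgeConjecture.HodgeConjecture.Cruxes.HLiu418.K2LiuArchKTypeScalars

end
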